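import Summits.AtomisticToContinuum.Crystallization.Theorems.PalmUnimodularRigidityShellsToBarlowChartTransportSteps1
import Summits.AtomisticToContinuum.Crystallization.Theorems.PalmUnimodularRigidityShellsToBarlowChartTransportSteps2
import Summits.AtomisticToContinuum.Crystallization.Theorems.PalmUnimodularRigidityShellsToBarlowChartTransportSteps6
import Summits.AtomisticToContinuum.Crystallization.Theorems.PalmUnimodularRigidityShellsToBarlowChartTransportVinv

/-!
# Line `develop-the-model-growth-descent` (crux `ShellsToBarlowChart`, stmt-AtomisticToContinuum-9227): swap symmetry and the attachment of transported caps (part 1/2)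

Helper lemmas for `stub_transportSystem` (the geometric half of the line): frames `⟨x, t₁, t₂, U⟩`
read in the integer charts `IsZChart` of a good-shell configuration, their transports and the
coherence of the resulting development `frameAt`.  The only metric inputs are the chart transfer
lemma and `bond_nb_iff`; everything else is label combinatorics in `ℤ³` (pattern facts
`TransportPatterns*`).  All `[folklore]` (HalesDSP2012 §1.3 for the two kissing patterns).
-/

noncomputable section

namespace Summit.AtomisticToContinuum.Crystallization.Theorems.PalmUnimodularRigidityShellsToBarlowChart

open Literature.Geometry.DiscreteGeometry Literature.MathematicalPhysics.StatisticalMechanics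
open Summit.AtomisticToContinuum.Crystallization.Theorems.ShellsToBarlowChartNegative

variable {S : Set (EuclideanSpace ℝ (Fin 3))} {ac : (EuclideanSpace ℝ (Fin 3)) → ℝ} {Pc : (EuclideanSpace ℝ (Fin 3)) → Finset (Fin 3 → ℤ)}
  {Ac : (EuclideanSpace ℝ (Fin 3)) → ((EuclideanSpace ℝ (Fin 3)) →ₗᵢ[ℝ] (EuclideanSpace ℝ (Fin 3)))} {nb : (EuclideanSpace ℝ (Fin 3)) → (Fin 3 → ℤ) → (EuclideanSpace ℝ (Fin 3))}

/-- The hexagon of `(a, b)` is the hexagon of `(b, a)`. [folklore] -/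
theorem hexLabels_comm (a b : Fin 3 → ℤ) : hexLabels a b = hexLabels b a := by
  ext p
  simp only [mem_hexLabels_iff]
  constructor
  · rintro (h | h | h | h | h | h) <;> simp only [h, true_or, or_true]
  · rintro (h | h | h | h | h | h) <;> simp only [h, true_or, or_true]

/-- `capWithAny` is symmetric in the two directions. [folklore] -/
theorem capWithAny_comm (P : Finset (Fin 3 → ℤ)) (a b : Fin 3 → ℤ) (μs : Finset (Fin 3 → ℤ)) :
    capWithAny P a b μs = capWithAny P b a μs := by
  simp only [capWithAny, hexLabels_comm a b]

/-- `capWith` is symmetric in the two directions. [folklore] -/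
theorem capWith_comm (P : Finset (Fin 3 → ℤ)) (a b μ : Fin 3 → ℤ) :
    capWith P a b μ = capWith P b a μ := by
  simp only [capWith, hexLabels_comm a b]

/-- `capOpp` is symmetric in the two directions. [folklore] -/
theorem capOpp_comm (P : Finset (Fin 3 → ℤ)) (a b μ : Fin 3 → ℤ) :
    capOpp P a b μ = capOpp P b a μ := by
  simp only [capOpp, hexLabels_comm a b]

/-- `lowerCap` is symmetric in the two directions. [folklore] -/
theorem lowerCap_comm (P : Finset (Fin 3 → ℤ)) (a b : Fin 3 → ℤ) (U : Finset (Fin 3 → ℤ)) :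
    lowerCap P a b U = lowerCap P b a U := by
  simp only [lowerCap, hexLabels_comm a b]

/-- Frame validity is symmetric in the two directions. [folklore] -/
theorem isFrame_swap {P : Finset (Fin 3 → ℤ)} {a b : Fin 3 → ℤ} {U : Finset (Fin 3 → ℤ)}
    (h : IsFrame P a b U) : IsFrame P b a U := by
  obtain ⟨h12, hhex, hUP, hoff, c, hcU, hform⟩ := h
  refine ⟨by rw [sqNormInt_sub_comm]; exact h12, by rw [hexLabels_comm]; exact hhex, hUP,
    fun u hu => by rw [hexLabels_comm]; exact hoff u hu, c, hcU, ?_⟩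
  rcases hform with hE | hO
  · left; rw [hE, Finset.pair_comm]
  · right; rw [hO, Finset.pair_comm]

/-- The parity of a frame is symmetric in the two directions. [folklore] -/
theorem frameParity_swap (a b : Fin 3 → ℤ) (U : Finset (Fin 3 → ℤ)) :
    frameParity b a U = frameParity a b U := by
  unfold frameParity
  by_cases h : ∃ c ∈ U, sqNormInt (c - a) = 18 ∧ sqNormInt (c - b) = 18
  · have h' : ∃ c ∈ U, sqNormInt (c - b) = 18 ∧ sqNormInt (c - a) = 18 := by
      obtain ⟨c, hc, h1, h2⟩ := h; exact ⟨c, hc, h2, h1⟩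
    rw [if_pos h', if_pos h]
  · have h' : ¬ ∃ c ∈ U, sqNormInt (c - b) = 18 ∧ sqNormInt (c - a) = 18 := by
      rintro ⟨c, hc, h1, h2⟩; exact h ⟨c, hc, h2, h1⟩
    rw [if_neg h', if_neg h]

/-- The letter read on a cap is symmetric in the two directions. [folklore] -/
theorem lowerParity_swap (a b : Fin 3 → ℤ) (C : Finset (Fin 3 → ℤ)) :
    lowerParity b a C = lowerParity a b C := by
  unfold lowerParity
  by_cases h : ∃ c ∈ C, c + a ∈ C ∧ c + b ∈ C
  · have h' : ∃ c ∈ C, c + b ∈ C ∧ c + a ∈ C := by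
      obtain ⟨c, hc, h1, h2⟩ := h; exact ⟨c, hc, h2, h1⟩
    rw [if_pos h', if_pos h]
  · have h' : ¬ ∃ c ∈ C, c + b ∈ C ∧ c + a ∈ C := by
      rintro ⟨c, hc, h1, h2⟩; exact h ⟨c, hc, h2, h1⟩
    rw [if_neg h', if_neg h]

/-- The apex of a valid cap is symmetric in the two directions. [folklore] -/
theorem apexOf_swap {P : Finset (Fin 3 → ℤ)} (hP : P = fcc3Int ∨ P = hcpInt) {a b : Fin 3 → ℤ}
    {U : Finset (Fin 3 → ℤ)} (hU : IsFrame P a b U) : apexOf b a U = apexOf a b U := by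
  obtain ⟨-, -, -, -, c, hcU, hform⟩ := id hU
  rw [apexOf_eq_of_form hP hU hcU hform]
  refine apexOf_eq_of_form hP (isFrame_swap hU) hcU ?_
  rcases hform with hE | hO
  · left; rw [hE, Finset.pair_comm]
  · right; rw [hO, Finset.pair_comm]

/-- **`J = swap ∘ I ∘ swap`.** [folklore] -/
theorem Jstep_swap (x : (EuclideanSpace ℝ (Fin 3))) (t₁ t₂ : Fin 3 → ℤ) (U : Finset (Fin 3 → ℤ)) :
    Jstep Pc nb ⟨x, t₁, t₂, U⟩ = ⟨(Istep Pc nb ⟨x, t₂, t₁, U⟩).pt, (Istep Pc nb ⟨x, t₂, t₁, U⟩).t₂,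
      (Istep Pc nb ⟨x, t₂, t₁, U⟩).t₁, (Istep Pc nb ⟨x, t₂, t₁, U⟩).U⟩ := by
  simp only [Jstep, Istep, capWithAny_comm _ (-zlab Pc nb (nb x t₂) x)]

/-- **`J⁻¹ = swap ∘ I⁻¹ ∘ swap`.** [folklore] -/
theorem JinvStep_swap (x : (EuclideanSpace ℝ (Fin 3))) (t₁ t₂ : Fin 3 → ℤ) (U : Finset (Fin 3 → ℤ)) :
    JinvStep Pc nb ⟨x, t₁, t₂, U⟩ = ⟨(IinvStep Pc nb ⟨x, t₂, t₁, U⟩).pt,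
      (IinvStep Pc nb ⟨x, t₂, t₁, U⟩).t₂, (IinvStep Pc nb ⟨x, t₂, t₁, U⟩).t₁,
      (IinvStep Pc nb ⟨x, t₂, t₁, U⟩).U⟩ := by
  simp only [JinvStep, IinvStep, capWithAny_comm _ (zlab Pc nb (nb x (-t₂)) x)]

/-- **`V ∘ swap = swap ∘ V`** on valid frames. [folklore] -/
theorem Vstep_swap {x : (EuclideanSpace ℝ (Fin 3))} (hP : Pc x = fcc3Int ∨ Pc x = hcpInt) {t₁ t₂ : Fin 3 → ℤ}
    {U : Finset (Fin 3 → ℤ)} (hU : IsFrame (Pc x) t₁ t₂ U) :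
    Vstep Pc nb ⟨x, t₂, t₁, U⟩ = ⟨(Vstep Pc nb ⟨x, t₁, t₂, U⟩).pt, (Vstep Pc nb ⟨x, t₁, t₂, U⟩).t₂,
      (Vstep Pc nb ⟨x, t₁, t₂, U⟩).t₁, (Vstep Pc nb ⟨x, t₁, t₂, U⟩).U⟩ := by
  have ha : apexOf t₂ t₁ U = apexOf t₁ t₂ U := apexOf_swap hP hU
  have hp : frameParity t₂ t₁ U = frameParity t₁ t₂ U := frameParity_swap t₁ t₂ U
  simp only [Vstep, ha, hp]
  split_ifs <;> rw [capOpp_comm]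

/-- **`V⁻¹ ∘ swap = swap ∘ V⁻¹`** on valid frames. [folklore] -/
theorem VinvStep_swap {x : (EuclideanSpace ℝ (Fin 3))} (hP : Pc x = fcc3Int ∨ Pc x = hcpInt) {t₁ t₂ : Fin 3 → ℤ}
    {U : Finset (Fin 3 → ℤ)} (hU : IsFrame (Pc x) t₁ t₂ U) :
    VinvStep Pc nb ⟨x, t₂, t₁, U⟩ = ⟨(VinvStep Pc nb ⟨x, t₁, t₂, U⟩).pt,
      (VinvStep Pc nb ⟨x, t₁, t₂, U⟩).t₂, (VinvStep Pc nb ⟨x, t₁, t₂, U⟩).t₁,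
      (VinvStep Pc nb ⟨x, t₁, t₂, U⟩).U⟩ := by
  have hL : lowerCap (Pc x) t₂ t₁ U = lowerCap (Pc x) t₁ t₂ U := lowerCap_comm _ _ _ _
  have ha : apexOf t₂ t₁ (lowerCap (Pc x) t₁ t₂ U) = apexOf t₁ t₂ (lowerCap (Pc x) t₁ t₂ U) :=
    apexOf_swap hP (isFrame_lowerCap hP hU)
  have hp : lowerParity t₂ t₁ (lowerCap (Pc x) t₁ t₂ U) =
      lowerParity t₁ t₂ (lowerCap (Pc x) t₁ t₂ U) := lowerParity_swap _ _ _
  simp only [VinvStep, hL, ha, hp]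
  split_ifs <;> rw [capWith_comm]

/-- A valid frame of parity `+1` has the even cap `{c, c − t₁, c − t₂}`, `c` its apex. [folklore] -/
theorem even_form_of_parity {P : Finset (Fin 3 → ℤ)} (hP : P = fcc3Int ∨ P = hcpInt)
    {t₁ t₂ : Fin 3 → ℤ} {U : Finset (Fin 3 → ℤ)} (hU : IsFrame P t₁ t₂ U)
    (hpar : frameParity t₁ t₂ U = 1) :
    apexOf t₁ t₂ U ∈ U ∧ apexOf t₁ t₂ U ∈ P ∧ apexOf t₁ t₂ U ∉ hexLabels t₁ t₂ ∧
      apexOf t₁ t₂ U - t₁ ∈ P ∧ apexOf t₁ t₂ U - t₂ ∈ P ∧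
      U = {apexOf t₁ t₂ U, apexOf t₁ t₂ U - t₁, apexOf t₁ t₂ U - t₂} := by
  obtain ⟨h12, hhex, hUP, hoff, c, hcU, hform⟩ := id hU
  have ht₁ : t₁ ∈ P := hhex (mem_hexLabels_iff.2 (Or.inl rfl))
  have ht₂ : t₂ ∈ P := hhex (mem_hexLabels_iff.2 (Or.inr (Or.inl rfl)))
  have hcP : c ∈ P := hUP hcU
  have hc : c ∉ hexLabels t₁ t₂ := hoff c hcU
  have hE : U = {c, c - t₁, c - t₂} := by
    rcases hform with hE | hO
    · exact hE
    · exfalso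
      have hc1 : c + t₁ ∈ P := hUP (by rw [hO]; simp)
      have hc2 : c + t₂ ∈ P := hUP (by rw [hO]; simp)
      have h := (isFrame_oddCap P hP t₁ ht₁ t₂ ht₂ c hcP h12 hhex hc hc1 hc2).2
      rw [← hO, hpar] at h
      norm_num at h
  have hapex : apexOf t₁ t₂ U = c := apexOf_eq_of_form hP hU hcU (Or.inl hE)
  rw [hapex]
  exact ⟨hcU, hcP, hc, hUP (by rw [hE]; simp), hUP (by rw [hE]; simp), hE⟩

/-- A valid frame of parity `−1` has the odd cap `{c, c + t₁, c + t₂}`, `c` its apex. [folklore] -/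
theorem odd_form_of_parity {P : Finset (Fin 3 → ℤ)} (hP : P = fcc3Int ∨ P = hcpInt)
    {t₁ t₂ : Fin 3 → ℤ} {U : Finset (Fin 3 → ℤ)} (hU : IsFrame P t₁ t₂ U)
    (hpar : frameParity t₁ t₂ U = -1) :
    apexOf t₁ t₂ U ∈ U ∧ apexOf t₁ t₂ U ∈ P ∧ apexOf t₁ t₂ U ∉ hexLabels t₁ t₂ ∧
      apexOf t₁ t₂ U + t₁ ∈ P ∧ apexOf t₁ t₂ U + t₂ ∈ P ∧
      U = {apexOf t₁ t₂ U, apexOf t₁ t₂ U + t₁, apexOf t₁ t₂ U + t₂} := by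
  obtain ⟨h12, hhex, hUP, hoff, c, hcU, hform⟩ := id hU
  have ht₁ : t₁ ∈ P := hhex (mem_hexLabels_iff.2 (Or.inl rfl))
  have ht₂ : t₂ ∈ P := hhex (mem_hexLabels_iff.2 (Or.inr (Or.inl rfl)))
  have hcP : c ∈ P := hUP hcU
  have hc : c ∉ hexLabels t₁ t₂ := hoff c hcU
  have hO : U = {c, c + t₁, c + t₂} := by
    rcases hform with hE | hO
    · exfalso
      have hc1 : c - t₁ ∈ P := hUP (by rw [hE]; simp)
      have hc2 : c - t₂ ∈ P := hUP (by rw [hE]; simp)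
      have h := (isFrame_evenCap P hP t₁ ht₁ t₂ ht₂ c hcP h12 hhex hc hc1 hc2).2
      rw [← hE, hpar] at h
      norm_num at h
    · exact hO
  have hapex : apexOf t₁ t₂ U = c := apexOf_eq_of_form hP hU hcU (Or.inr hO)
  rw [hapex]
  exact ⟨hcU, hcP, hc, hUP (by rw [hO]; simp), hUP (by rw [hO]; simp), hO⟩

/-- The lower cap of a frame reading letter `+1` below is `{d, d + t₁, d + t₂}`, `d` its apex.
[folklore] -/
theorem pos_form_of_lowerParity {P : Finset (Fin 3 → ℤ)} (hP : P = fcc3Int ∨ P = hcpInt)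
    {t₁ t₂ : Fin 3 → ℤ} {U : Finset (Fin 3 → ℤ)} (hU : IsFrame P t₁ t₂ U)
    (hlp : lowerParity t₁ t₂ (lowerCap P t₁ t₂ U) = 1) :
    apexOf t₁ t₂ (lowerCap P t₁ t₂ U) ∈ lowerCap P t₁ t₂ U ∧ apexOf t₁ t₂ (lowerCap P t₁ t₂ U) ∈ P ∧
      apexOf t₁ t₂ (lowerCap P t₁ t₂ U) ∉ hexLabels t₁ t₂ ∧
      apexOf t₁ t₂ (lowerCap P t₁ t₂ U) + t₁ ∈ P ∧ apexOf t₁ t₂ (lowerCap P t₁ t₂ U) + t₂ ∈ P ∧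
      lowerCap P t₁ t₂ U = {apexOf t₁ t₂ (lowerCap P t₁ t₂ U),
        apexOf t₁ t₂ (lowerCap P t₁ t₂ U) + t₁, apexOf t₁ t₂ (lowerCap P t₁ t₂ U) + t₂} := by
  obtain ⟨d, hdL, hdP, hdhex, hcase⟩ := lowerCap_cases hP hU
  rcases hcase with ⟨hLeq, -, hd1, hd2⟩ | ⟨-, hlp', -, -⟩
  · have hapex : apexOf t₁ t₂ (lowerCap P t₁ t₂ U) = d :=
      apexOf_eq_of_form hP (isFrame_lowerCap hP hU) hdL (Or.inr hLeq)
    rw [hapex]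
    exact ⟨hdL, hdP, hdhex, hd1, hd2, hLeq⟩
  · rw [hlp] at hlp'; norm_num at hlp'

/-- The lower cap of a frame reading letter `−1` below is `{d, d − t₁, d − t₂}`, `d` its apex.
[folklore] -/
theorem neg_form_of_lowerParity {P : Finset (Fin 3 → ℤ)} (hP : P = fcc3Int ∨ P = hcpInt)
    {t₁ t₂ : Fin 3 → ℤ} {U : Finset (Fin 3 → ℤ)} (hU : IsFrame P t₁ t₂ U)
    (hlp : lowerParity t₁ t₂ (lowerCap P t₁ t₂ U) = -1) :
    apexOf t₁ t₂ (lowerCap P t₁ t₂ U) ∈ lowerCap P t₁ t₂ U ∧ apexOf t₁ t₂ (lowerCap P t₁ t₂ U) ∈ P ∧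
      apexOf t₁ t₂ (lowerCap P t₁ t₂ U) ∉ hexLabels t₁ t₂ ∧
      apexOf t₁ t₂ (lowerCap P t₁ t₂ U) - t₁ ∈ P ∧ apexOf t₁ t₂ (lowerCap P t₁ t₂ U) - t₂ ∈ P ∧
      lowerCap P t₁ t₂ U = {apexOf t₁ t₂ (lowerCap P t₁ t₂ U),
        apexOf t₁ t₂ (lowerCap P t₁ t₂ U) - t₁, apexOf t₁ t₂ (lowerCap P t₁ t₂ U) - t₂} := by
  obtain ⟨d, hdL, hdP, hdhex, hcase⟩ := lowerCap_cases hP hU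
  rcases hcase with ⟨-, hlp', -, -⟩ | ⟨hLeq, -, hd1, hd2⟩
  · rw [hlp] at hlp'; norm_num at hlp'
  · have hapex : apexOf t₁ t₂ (lowerCap P t₁ t₂ U) = d :=
      apexOf_eq_of_form hP (isFrame_lowerCap hP hU) hdL (Or.inl hLeq)
    rw [hapex]
    exact ⟨hdL, hdP, hdhex, hd1, hd2, hLeq⟩

/-- **Upper attachment across I, even layer**: the apex site `nb x c` of an even frame is the
neighbour of `Ix` labelled `c₊ − t₁₊` (`c₊` the apex of the transported cap): in the model,
`(k+1, i, j)` is the upper neighbour of `(k, i+1, j)` with offset `(1, 0)`. [folklore] -/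
theorem attach_I_even (hch : ∀ z ∈ S, IsZChart S z (ac z) (Pc z) (Ac z) (nb z)) {x : (EuclideanSpace ℝ (Fin 3))}
    (hx : x ∈ S) {t₁ t₂ : Fin 3 → ℤ} {U : Finset (Fin 3 → ℤ)} (hU : IsFrame (Pc x) t₁ t₂ U)
    (hpar : frameParity t₁ t₂ U = 1)
    (hreg : Pc (nb x t₁) = fcc3Int ∨ Pc x = hcpInt ∨
      (-zlab Pc nb (nb x t₁) x ∈ Pc (nb x t₁) ∧ -zlab Pc nb (nb x t₁) (nb x t₂) ∈ Pc (nb x t₁))) :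
    nb (nb x t₁) (apexOf (Istep Pc nb ⟨x, t₁, t₂, U⟩).t₁ (Istep Pc nb ⟨x, t₁, t₂, U⟩).t₂
        (Istep Pc nb ⟨x, t₁, t₂, U⟩).U - (Istep Pc nb ⟨x, t₁, t₂, U⟩).t₁) = nb x (apexOf t₁ t₂ U) ∧
    zlab Pc nb (nb x t₁) (nb x (apexOf t₁ t₂ U)) =
      apexOf (Istep Pc nb ⟨x, t₁, t₂, U⟩).t₁ (Istep Pc nb ⟨x, t₁, t₂, U⟩).t₂
        (Istep Pc nb ⟨x, t₁, t₂, U⟩).U - (Istep Pc nb ⟨x, t₁, t₂, U⟩).t₁ := by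
  obtain ⟨hyS, -, -, -, -, -, -, -, -, -, -, hframe, hparI, c₁, hc₁U, -, hfilt, hbu, -, -, hfiltU⟩ :=
    Istep_spec hch hx hU hreg
  have hPx := pattern_cases hch hx
  have hPy := pattern_cases hch hyS
  obtain ⟨h12, hhex, -, -, -⟩ := id hU
  have ht₁ : t₁ ∈ Pc x := hhex (mem_hexLabels_iff.2 (Or.inl rfl))
  have ht₂ : t₂ ∈ Pc x := hhex (mem_hexLabels_iff.2 (Or.inr (Or.inl rfl)))
  obtain ⟨hcU, hcP, hc, hc1, hc2, hE⟩ := even_form_of_parity hPx hU hpar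
  set c := apexOf t₁ t₂ U with hc_def
  have hc₁ : c₁ = c := by
    have h1 := (filter_evenCap (Pc x) hPx t₁ ht₁ t₂ ht₂ c hcP h12 hhex hc hc1 hc2).1
    rw [← hE, hfilt] at h1
    exact Finset.singleton_injective h1
  rw [hc₁] at hbu hfiltU
  have hμ := zlab_spec hch hyS (nb_mem hch hx hcP).1 hbu
  -- the transported cap is even with apex `c'`
  have hpar' := hparI.trans hpar
  set a' := (Istep Pc nb ⟨x, t₁, t₂, U⟩).t₁ with ha'
  set b' := (Istep Pc nb ⟨x, t₁, t₂, U⟩).t₂ with hb'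
  set U' := (Istep Pc nb ⟨x, t₁, t₂, U⟩).U with hU'
  obtain ⟨h12', hhex', -, -, -⟩ := id hframe
  have ha'P : a' ∈ Pc (nb x t₁) := hhex' (mem_hexLabels_iff.2 (Or.inl rfl))
  have hb'P : b' ∈ Pc (nb x t₁) := hhex' (mem_hexLabels_iff.2 (Or.inr (Or.inl rfl)))
  obtain ⟨-, hc'P, hc', hc1', hc2', hE'⟩ := even_form_of_parity hPy hframe hpar'
  set c' := apexOf a' b' U' with hc'_def
  have hμeq : zlab Pc nb (nb x t₁) (nb x c) = c' - a' := by
    have h1 := (filter_evenCap (Pc (nb x t₁)) hPy a' ha'P b' hb'P c' hc'P h12' hhex' hc' hc1' hc2').2.2.1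
    rw [← hE', hfiltU] at h1
    exact Finset.singleton_injective h1
  refine ⟨?_, hμeq⟩
  rw [← hμeq]; exact hμ.2

/-- **Upper attachment across I, odd layer**: the apex site of `Ix` is the neighbour of `x`
labelled `c + t₁`: in the model, `(k+1, i+1, j)` is an upper neighbour of `(k, i, j)`.
[folklore] -/
theorem attach_I_odd (hch : ∀ z ∈ S, IsZChart S z (ac z) (Pc z) (Ac z) (nb z)) {x : (EuclideanSpace ℝ (Fin 3))}
    (hx : x ∈ S) {t₁ t₂ : Fin 3 → ℤ} {U : Finset (Fin 3 → ℤ)} (hU : IsFrame (Pc x) t₁ t₂ U)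
    (hpar : frameParity t₁ t₂ U = -1)
    (hreg : Pc (nb x t₁) = fcc3Int ∨ Pc x = hcpInt ∨
      (-zlab Pc nb (nb x t₁) x ∈ Pc (nb x t₁) ∧ -zlab Pc nb (nb x t₁) (nb x t₂) ∈ Pc (nb x t₁))) :
    nb (nb x t₁) (apexOf (Istep Pc nb ⟨x, t₁, t₂, U⟩).t₁ (Istep Pc nb ⟨x, t₁, t₂, U⟩).t₂
        (Istep Pc nb ⟨x, t₁, t₂, U⟩).U) = nb x (apexOf t₁ t₂ U + t₁) ∧
    zlab Pc nb (nb x t₁) (nb x (apexOf t₁ t₂ U + t₁)) =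
      apexOf (Istep Pc nb ⟨x, t₁, t₂, U⟩).t₁ (Istep Pc nb ⟨x, t₁, t₂, U⟩).t₂
        (Istep Pc nb ⟨x, t₁, t₂, U⟩).U := by
  obtain ⟨hyS, -, -, -, -, -, -, -, -, -, -, hframe, hparI, c₁, hc₁U, -, hfilt, hbu, -, -, hfiltU⟩ :=
    Istep_spec hch hx hU hreg
  have hPx := pattern_cases hch hx
  have hPy := pattern_cases hch hyS
  obtain ⟨h12, hhex, -, -, -⟩ := id hU
  have ht₁ : t₁ ∈ Pc x := hhex (mem_hexLabels_iff.2 (Or.inl rfl))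
  have ht₂ : t₂ ∈ Pc x := hhex (mem_hexLabels_iff.2 (Or.inr (Or.inl rfl)))
  obtain ⟨hcU, hcP, hc, hc1, hc2, hO⟩ := odd_form_of_parity hPx hU hpar
  set c := apexOf t₁ t₂ U with hc_def
  have hc₁ : c₁ = c + t₁ := by
    have h1 := (filter_oddCap (Pc x) hPx t₁ ht₁ t₂ ht₂ c hcP h12 hhex hc hc1 hc2).1
    rw [← hO, hfilt] at h1
    exact Finset.singleton_injective h1
  rw [hc₁] at hbu hfiltU
  have hμ := zlab_spec hch hyS (nb_mem hch hx hc1).1 hbu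
  have hpar' := hparI.trans hpar
  set a' := (Istep Pc nb ⟨x, t₁, t₂, U⟩).t₁ with ha'
  set b' := (Istep Pc nb ⟨x, t₁, t₂, U⟩).t₂ with hb'
  set U' := (Istep Pc nb ⟨x, t₁, t₂, U⟩).U with hU'
  obtain ⟨h12', hhex', -, -, -⟩ := id hframe
  have ha'P : a' ∈ Pc (nb x t₁) := hhex' (mem_hexLabels_iff.2 (Or.inl rfl))
  have hb'P : b' ∈ Pc (nb x t₁) := hhex' (mem_hexLabels_iff.2 (Or.inr (Or.inl rfl)))
  obtain ⟨-, hc'P, hc', hc1', hc2', hO'⟩ := odd_form_of_parity hPy hframe hpar'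
  set c' := apexOf a' b' U' with hc'_def
  have hμeq : zlab Pc nb (nb x t₁) (nb x (c + t₁)) = c' := by
    have h1 := (filter_oddCap (Pc (nb x t₁)) hPy a' ha'P b' hb'P c' hc'P h12' hhex' hc' hc1' hc2').2.2.1
    rw [← hO', hfiltU] at h1
    exact Finset.singleton_injective h1
  refine ⟨?_, hμeq⟩
  rw [← hμeq]; exact hμ.2

end Summit.AtomisticToContinuum.Crystallization.Theorems.PalmUnimodularRigidityShellsToBarlowChart

end
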